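import Mathlib
import Summits.NavierStokesRegularity.NavierStokesRegularity.Theorems.RootDecompLitSliceCritTameScarIsCriticalClosed
import Summits.NavierStokesRegularity.NavierStokesRegularity.Theorems.RootDecompLitSliceT3LClockCell
import Summits.NavierStokesRegularity.NavierStokesRegularity.Theorems.RootDecompLitSliceEnergyClockLerayFloor
import HarnessLib

/-!
# Route RootDecompLitSlice — the √-CLOCK CLASS after the closure of Uᶜ: three unconditional corollaries

Bookkeeping helpers (`--supports stmt-NavierStokesRegularity-29562`, leaf T₃ᴸ `NoLitInvisibleTransient`; census
decomp-ns-census-1 g58, sequel of p838867). For a maximal smooth finite-energy solution (Leray–Hopf from a decaying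
datum) with the CRITICAL CLOCK `∫|u(t) − u(T)|² ≤ K√(T−t)` near its blow-up time `T`:

* `energyTypeI_of_sqrtClock` — ENERGY-TYPE-I at `T`: `∫‖u t‖² − ∫‖u T‖² ≤ C√(T−t)` near `T`
  (`CritTameScarIsCriticalClosed.laggedBound_of_sqrtClock` + `MeanFieldLaggedEndpoint.energyHalfHolder_of_laggedEndpointBound`;
  no tameness needed for this step);
* `energyDrop_twoSided_of_sqrtClock` — with the Leray floor (`EnergyClockScarLaw.energyDrop_ge_leray`) the energy
  drop is TWO-SIDED Type-I: `cν^{5/2}√(T−t) ≤ D(t) ≤ C√(T−t)` near `T`;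
* `parabolicBudget_of_sqrtClock` — if moreover tame at `T`: T₃ᴸ's OUTPUT at EVERY vertex (lit or dark), i.e. the
  scale-invariant local energy `r⁻¹∫_{B_r(x₀)}|u(t)|²` is bounded on the terminal cylinders `(T−r², T) × B_r(x₀)`
  (`T3LClockCell.budget_of_Uc_on_critClockCell` with Uᶜ supplied by `critTameScarIsCritical_proof`): on the √-clock
  class the N16 segment U → T₃ᴸ is settled; T₃ᴸ's open content lives on the abrupt cell only.

HONEST FRAMING: corollaries inside the zero-load clocked cell; the loads of the cell's blocker (Uᵃ ⟨31734⟩, P1 ⟨1217⟩)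
and T₃ᴸ's abrupt half are untouched. Rung 0: nothing here proves NS regularity. [folklore]
-/

set_option linter.dupNamespace false

namespace Summit.NavierStokesRegularity.NavierStokesRegularity.Theorems

open MeasureTheory Set Filter Topology
open scoped ENNReal
open Literature.Analysis.FluidPDE

namespace CritClockCorollaries

/-- ★ **Energy-Type-I on the √-clock class** (unconditional): classical on `[0,T)`, Leray–Hopf on `[0,T]`, critical
clock near `T` ⟹ `∫‖u t‖² − ∫‖u T‖² ≤ C√(T−t)` near `T`. [folklore] -/
theorem energyTypeI_of_sqrtClock (ν T : ℝ) (hν : 0 < ν) (hT : 0 < T)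
    (u : ℝ → EuclideanSpace ℝ (Fin 3) → EuclideanSpace ℝ (Fin 3)) (p : ℝ → EuclideanSpace ℝ (Fin 3) → ℝ)
    (hcl : IsClassicalNSSolutionOn (Ico 0 T) ν 0 u p) (hLH : IsLerayHopfOn T ν 0 (u 0) u)
    (hclock : ∃ K T₁ : ℝ, T₁ < T ∧ ∀ t ∈ Ioo T₁ T,
      ∫⁻ x, ‖u t x - u T x‖ₑ ^ 2 ≤ ENNReal.ofReal (K * Real.sqrt (T - t))) :
    ∃ C T₂ : ℝ, T₂ < T ∧ ∀ t ∈ Ioo T₂ T,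
      (∫ x, ‖u t x‖ ^ 2) - ∫ x, ‖u T x‖ ^ 2 ≤ C * Real.sqrt (T - t) :=
  MeanFieldLaggedEndpoint.energyHalfHolder_of_laggedEndpointBound ν T hν hT u p hcl hLH
    (CritTameScarIsCriticalClosed.laggedBound_of_sqrtClock ν T hν hT u p hcl hLH hclock)

/-- **Two-sided energy-Type-I on the √-clock class**: on the maximal frame (Leray–Hopf, decaying datum) with the
critical clock, `cν^{5/2}√(T−t) ≤ D(t) ≤ C√(T−t)` near `T` — Leray's floor below, the lagged endpoint above.
[folklore] -/
theorem energyDrop_twoSided_of_sqrtClock (ν T : ℝ) (hν : 0 < ν) (hT : 0 < T)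
    (u : ℝ → EuclideanSpace ℝ (Fin 3) → EuclideanSpace ℝ (Fin 3)) (p : ℝ → EuclideanSpace ℝ (Fin 3) → ℝ)
    (hmax : IsMaximalSmoothSolution ν 0 u p T) (hLH : IsLerayHopfOn T ν 0 (u 0) u)
    (hdec : HasRapidSpatialDecay (u 0))
    (hclock : ∃ K T₁ : ℝ, T₁ < T ∧ ∀ t ∈ Ioo T₁ T,
      ∫⁻ x, ‖u t x - u T x‖ₑ ^ 2 ≤ ENNReal.ofReal (K * Real.sqrt (T - t))) :
    ∃ c C T₂ : ℝ, 0 < c ∧ T₂ < T ∧ ∀ t ∈ Ioo T₂ T,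
      c * Real.sqrt (T - t) ≤ (∫ x, ‖u t x‖ ^ 2) - ∫ x, ‖u T x‖ ^ 2 ∧
        (∫ x, ‖u t x‖ ^ 2) - ∫ x, ‖u T x‖ ^ 2 ≤ C * Real.sqrt (T - t) := by
  obtain ⟨c, hc, hfloor⟩ := EnergyClockScarLaw.energyDrop_ge_leray
  obtain ⟨C, T₂, hT₂, hup⟩ := energyTypeI_of_sqrtClock ν T hν hT u p hmax.1 hLH hclock
  refine ⟨c * ν ^ (5 / 2 : ℝ), C, max T₂ 0, mul_pos hc (Real.rpow_pos_of_pos hν _),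
    max_lt hT₂ hT, fun t ht => ⟨?_, ?_⟩⟩
  · exact hfloor ν T hν hT u p hmax hLH hdec t ⟨(le_max_right T₂ 0).trans ht.1.le, ht.2⟩
  · exact hup t ⟨lt_of_le_of_lt (le_max_left T₂ 0) ht.1, ht.2⟩

/-- ★ **T₃ᴸ's output at every vertex on the √-clock class** (unconditional): a tame first blow-up with the critical
clock has bounded scale-invariant local energy `r⁻¹∫_{B_r(x₀)}|u(t)|²` on the terminal cylinders
`t ∈ (T−r², T)`, `r < r₀`, at EVERY `x₀` (`T3LClockCell.budget_of_Uc_on_critClockCell` ∘ `critTameScarIsCritical_proof`).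
[folklore] -/
theorem parabolicBudget_of_sqrtClock :
    ∀ (ν T : ℝ), 0 < ν → 0 < T → ∀ (u : ℝ → EuclideanSpace ℝ (Fin 3) → EuclideanSpace ℝ (Fin 3))
      (p : ℝ → EuclideanSpace ℝ (Fin 3) → ℝ),
      Literature.Analysis.FluidPDE.IsMaximalSmoothSolution ν 0 u p T →
      Literature.Analysis.FluidPDE.IsLerayHopfOn T ν 0 (u 0) u →
      Literature.Analysis.FluidPDE.HasRapidSpatialDecay (u 0) →
      Filter.Tendsto (fun t => MeasureTheory.eLpNorm (u t - u T) 2 MeasureTheory.volume) (nhdsWithin T (Set.Iio T))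
        (nhds 0) →
      (∃ K T₁ : ℝ, T₁ < T ∧ ∀ t ∈ Set.Ioo T₁ T,
        ∫⁻ x, ‖u t x - u T x‖ₑ ^ 2 ≤ ENNReal.ofReal (K * Real.sqrt (T - t))) →
      ∀ x₀ : EuclideanSpace ℝ (Fin 3), ∃ M r₀ : ℝ, 0 < r₀ ∧ ∀ r ∈ Set.Ioo 0 r₀, ∀ t ∈ Set.Ioo (T - r ^ 2) T,
          r⁻¹ * ∫ x in Metric.ball x₀ r, ‖u t x‖ ^ 2 ≤ M :=
  T3LClockCell.budget_of_Uc_on_critClockCell CritTameScarIsCriticalClosed.critTameScarIsCritical_proof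

end CritClockCorollaries

end Summit.NavierStokesRegularity.NavierStokesRegularity.Theorems
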